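import Summits.AnomalousDissipation.AnomalousDissipation.Theses.TwoAndHalfD

/-!
# Sketch — first lemmas of the three crux-idea cards for `TwoAndHalfD.TwohalfdNeg`
(stmt-AnomalousDissipation-0211), ideator 3, round 1.  Statements only (elaboration check).
All three are stated in the 2-D language of the route (planar Leray–Hopf flow `v_j` forced by `g`,
sourced scalar `θ_j` = third velocity component, Prandtl number one), exactly like
`ScalarAnomalySteadySourceFormal`; the lift to the 3-D wording of `TwohalfdNeg` is the route's
foreseen glue `ScalarLift2halfD` (route header, NOT DECOMPOSED YET (i)).
-/

namespace Summit.AnomalousDissipation.AnomalousDissipation.Cruxes.TwohalfdNeg.Ideator3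

open MeasureTheory Filter Topology
open Literature.Analysis.FunctionSpaces Literature.Analysis.FluidPDE

local notation "𝕋²" => UnitAddTorus (Fin 2)
local notation "E²" => EuclideanSpace ℝ (Fin 2)

/-- Common preamble of the scalar half of `TwohalfdNeg` in 2-D language: steady smooth planar force
`g` and steady smooth source `h`, `ν_j → 0`, planar global Leray–Hopf flows `v_j`, weak sourced
scalars `θ_j`, bounded mean planar energy and bounded mean scalar variance; conclusion: the mean
scalar dissipation `⟨ν_j‖∇θ_j‖²⟩ → 0`.  `Hyp v ν` is an extra hypothesis on the planar flows. -/
def ScalarHalfUnder (Hyp : (ℕ → ℝ) → (ℕ → ℝ → 𝕋² → E²) → Prop) : Prop :=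
  ∀ (g : 𝕋² → E²) (h : 𝕋² → ℝ), Torus.IsSmooth g → Torus.IsDivFree g → Torus.HasZeroMean g →
    Torus.IsSmooth h → Torus.HasZeroMean h →
    ∀ (ν : ℕ → ℝ) (v₀ : ℕ → 𝕋² → E²) (v : ℕ → ℝ → 𝕋² → E²) (θ₀ : ℕ → 𝕋² → ℝ) (θ : ℕ → ℝ → 𝕋² → ℝ),
      (∀ j, 0 < ν j) → Tendsto ν atTop (𝓝 0) →
      (∀ j, Torus.IsGlobalLerayHopf (ν j) (fun _ => g) (v₀ j) (v j)) →
      (∀ j, MemLp (θ₀ j) 2 volume) →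
      (∀ j, Torus.IsWeakScalarTransportForced (ν j) (v j) (fun _ => h) (θ₀ j) (θ j)) →
      (∃ E : ℝ, ∀ j, meanEnergy (v j) ≤ E) →
      (∃ E : ℝ, ∀ j, longTimeAvgSup (fun t => Torus.scalarL2Sq (θ j t)) ≤ E) →
      Hyp ν v →
      Tendsto (fun j => longTimeAvgSup (fun t => ν j * (Torus.eScalarGradNormSq (θ j t)).toReal)) atTop (𝓝 0)

/-- **Card `age-decoupling-finite-window`, first lemma (the reduction).**  Extra hypothesis
`FiniteWindowQuiet`: for every window length `S > 0`, the UNFORCED scalar released at time `s` with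
the fixed smooth datum `h` into the flow `v_j` (weak solution `ϑ j s` of `∂τϑ + v_j(s+τ)·∇ϑ = ν_jΔϑ`,
`ϑ(0) = h`, on `[0, S+1)`) dissipates, in long-time mean over release times `s`, a vanishing amount
of variance within age `S` as `j → ∞`.  Claim: then the sourced scalar has vanishing mean
dissipation (age-decoupling inequality `χ ≤ R/(2S) + √(2R·D_h(S))`). -/
def FiniteWindowQuiet (ν : ℕ → ℝ) (v : ℕ → ℝ → 𝕋² → E²) : Prop :=
  ∀ (h : 𝕋² → ℝ), Torus.IsSmooth h → Torus.HasZeroMean h →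
  ∀ S : ℝ, 0 < S → ∀ ϑ : ℕ → ℝ → ℝ → 𝕋² → ℝ,
    (∀ j (s : ℝ), 0 ≤ s → Torus.IsWeakScalarTransportOn (S + 1) (ν j) (fun τ => v j (s + τ)) h (ϑ j s)) →
    Tendsto (fun j => longTimeAvgSup (fun s => (Torus.eScalarDissipation (ν j) (ϑ j s) 0 S).toReal))
      atTop (𝓝 0)

/-- Card 1, first lemma. -/
def AgeDecouplingReduction : Prop := ScalarHalfUnder FiniteWindowQuiet

/-- **Card `lusin-lipschitz-log-count`, first lemma.**  Extra hypothesis: planar mean enstrophy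
`Z_j = ⟨‖∇v_j‖²⟩` grows slower than `log²(1/ν_j)`.  Claim: then no scalar anomaly (Crippa–De Lellis
logarithmic stretching bound for `W^{1,p}` drifts, `p ∈ (1,2]`, fed into the age-decoupling
inequality).  The degenerate case `sup_j Z_j < ∞` is the common trunk of the settled single-shell /
first-shell sub-cases (there via DiPerna–Lions). -/
def SubLogSqEnstrophy (ν : ℕ → ℝ) (v : ℕ → ℝ → 𝕋² → E²) : Prop :=
  Tendsto (fun j => longTimeAvgSup (fun t => (Torus.eGradNormSq (v j t)).toReal) / Real.log (ν j) ^ 2)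
    atTop (𝓝 0)

/-- Card 2, first lemma. -/
def SubLogSqEnstrophyNoAnomaly : Prop := ScalarHalfUnder SubLogSqEnstrophy

/-- Card 2, degenerate case (trunk of the settled sub-cases): uniformly bounded mean enstrophy. -/
def UniformEnstrophy (_ν : ℕ → ℝ) (v : ℕ → ℝ → 𝕋² → E²) : Prop :=
  ∃ Z : ℝ, ∀ j, longTimeAvgSup (fun t => (Torus.eGradNormSq (v j t)).toReal) ≤ Z

/-- Card 2, degenerate first lemma. -/
def UniformEnstrophyNoAnomaly : Prop := ScalarHalfUnder UniformEnstrophy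

/-- The planar scalar curl `∂₀g₁ - ∂₁g₀` through `Torus.gradient` of the components. -/
noncomputable def planarCurl (g : 𝕋² → E²) (x : 𝕋²) : ℝ :=
  Torus.gradient (fun y => g y 1) x 0 - Torus.gradient (fun y => g y 0) x 1

/-- **Card `vorticity-coscalar-certificate`, first lemma (degenerate collinear case).**  If the
source is a multiple of the planar vorticity source, `h = c · curl g`, then `θ_j - c ω_j` solves the
unforced equation and relaxes, so bounded scalar variance certifies `ν`-uniform mean enstrophy and
the trunk `UniformEnstrophyNoAnomaly` applies: no anomaly.  Stated self-contained. -/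
def CollinearSourceNoAnomaly : Prop :=
  ∀ (g : 𝕋² → E²) (h : 𝕋² → ℝ), Torus.IsSmooth g → Torus.IsDivFree g → Torus.HasZeroMean g →
    Torus.IsSmooth h → Torus.HasZeroMean h → (∃ c : ℝ, ∀ x, h x = c * planarCurl g x) →
    ∀ (ν : ℕ → ℝ) (v₀ : ℕ → 𝕋² → E²) (v : ℕ → ℝ → 𝕋² → E²) (θ₀ : ℕ → 𝕋² → ℝ) (θ : ℕ → ℝ → 𝕋² → ℝ),
      (∀ j, 0 < ν j) → Tendsto ν atTop (𝓝 0) →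
      (∀ j, Torus.IsGlobalLerayHopf (ν j) (fun _ => g) (v₀ j) (v j)) →
      (∀ j, MemLp (θ₀ j) 2 volume) →
      (∀ j, Torus.IsWeakScalarTransportForced (ν j) (v j) (fun _ => h) (θ₀ j) (θ j)) →
      (∃ E : ℝ, ∀ j, meanEnergy (v j) ≤ E) →
      (∃ E : ℝ, ∀ j, longTimeAvgSup (fun t => Torus.scalarL2Sq (θ j t)) ≤ E) →
      Tendsto (fun j => longTimeAvgSup (fun t => ν j * (Torus.eScalarGradNormSq (θ j t)).toReal)) atTop (𝓝 0)

/-- Sanity: the uniform-enstrophy trunk is the `Z_j = O(1)` case of the sub-log² lemma (statement-level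
implication to be proved by provers; recorded here only as a Prop). -/
def TrunkFromSubLog : Prop := SubLogSqEnstrophyNoAnomaly → UniformEnstrophyNoAnomaly

end Summit.AnomalousDissipation.AnomalousDissipation.Cruxes.TwohalfdNeg.Ideator3
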